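import Literature.Algebra.Homology.PolyInfiniteCyclicCohomology
import Mathlib.LinearAlgebra.Matrix.GeneralLinearGroup.Defs
import Mathlib.LinearAlgebra.LinearIndependent.Lemmas
import Mathlib.LinearAlgebra.Matrix.Notation
import HarnessLib

/-!
# The upper triangular groups `{(a b; 0 d) : a ∈ A, d ∈ D, b ∈ Λ}` over a field are poly-ℤ:
# finitely generated cohomology with finitely generated coefficients

Topic `NumberTheory/Automorphic`; namespace `Literature.NumberTheory.Automorphic`, grouping
sub-namespace `BorelLattice`.  Definitions with bodies and theorems (no named fact, no instance
beyond the subgroup structures, no `sorry`).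

For a field `K`, a `ℤ`-submodule `Λ ≤ K` and subgroups `A, D ≤ Kˣ` with `A Λ ⊆ Λ`, `Λ D ⊆ Λ`, the
set `B(Λ, A, D) = {(a b; 0 d) : a ∈ A, d ∈ D, b ∈ Λ}` is a subgroup of `GL₂(K)` (`BorelLattice.borelOf`;
the matrices `bMat a b d = (a b; 0 d)`).  These are the shapes of the arithmetic subgroups of the
Borel subgroup of `GL₂` over a number field — the stabilisers of the boundary points
`diag(t) c K_f(𝔫)` in `B(K)` are sandwiched between two of them with `Λ` a fractional-ideal box and
`A = D` groups of units (`ResGL2BorelStabilizer`).  When `Λ = ⊕ ℤ bᵢ` for a `ℤ`-linearly independent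
family `b : Fin r → K` and `A`, `D` are generated by multiplicatively independent families
`u : Fin s → Kˣ`, `u' : Fin s' → Kˣ` (`BorelLattice.unitSpan`) preserving `Λ`, the group
`B(Λ, A, D)` has a subnormal chain with infinite cyclic quotients —
`B(ℤb₀) ≤ B(ℤb₀ ⊕ ℤb₁) ≤ ⋯ ≤ B(Λ) ≤ B(Λ, ⟨u₀⟩) ≤ ⋯ ≤ B(Λ, A) ≤ B(Λ, A, ⟨u'₀⟩) ≤ ⋯ ≤ B(Λ, A, D)`
(`BorelLattice.chain`) — so by the poly-ℤ induction of
`Literature.Algebra.Homology.moduleFinite_groupCohomology_of_chain` (Wang sequences):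

* `BorelLattice.moduleFinite_groupCohomology_borelOf` — **`Hⁿ(B(Λ, A, D), V)` is finitely generated
  over a Noetherian `k` for every representation `V` finitely generated over `k` and every `n`**;
  with `moduleFinite_groupCohomology_of_commensurable` (`GroupCohomologyFiniteIndexModuleFinite`) the
  same holds for every subgroup of `GL₂(K)` commensurable with `B(Λ, A, D)`.

This is the finiteness of the cohomology of the Borel–Serre boundary strata (torus bundles over
tori) of the arithmetic quotients of `GL₂` over a number field with infinite unit group, in the
group-cohomological model [Harder1987, §2], [Brown1982CohomologyGroups, VIII §2, (5.1)].

## References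

* G. Harder, *Eisenstein cohomology of arithmetic groups. The case GL₂*, Invent. Math. 89 (1987), §2
  [Harder1987].
* K. S. Brown, *Cohomology of Groups*, GTM 87 (1982), VIII §2, VIII (5.1) [Brown1982CohomologyGroups].
-/

noncomputable section

open CategoryTheory

namespace Literature.NumberTheory.Automorphic

namespace BorelLattice

variable {K : Type} [Field K]

/-! ### The matrices `(a b; 0 d)` -/

/-- The invertible upper triangular matrix `(a b; 0 d)`, `a, d ∈ Kˣ`, `b ∈ K`. [folklore] -/
def bMat (a : Kˣ) (b : K) (d : Kˣ) : GL (Fin 2) K :=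
  Matrix.GeneralLinearGroup.mkOfDetNeZero !![(a : K), b; 0, (d : K)] (by
    rw [Matrix.det_fin_two_of]
    simp [a.ne_zero, d.ne_zero])

/-- The underlying matrix of `bMat a b d`. [folklore] -/
@[simp]
theorem coe_bMat (a : Kˣ) (b : K) (d : Kˣ) :
    ((bMat a b d : GL (Fin 2) K) : Matrix (Fin 2) (Fin 2) K) = !![(a : K), b; 0, (d : K)] :=
  rfl

/-- **Multiplication**: `(a b; 0 d)(a' b'; 0 d') = (aa', ab' + bd'; 0, dd')`. [folklore] -/
theorem bMat_mul (a : Kˣ) (b : K) (d : Kˣ) (a' : Kˣ) (b' : K) (d' : Kˣ) :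
    bMat a b d * bMat a' b' d' = bMat (a * a') ((a : K) * b' + b * d') (d * d') := by
  refine Units.ext ?_
  rw [Units.val_mul, coe_bMat, coe_bMat, coe_bMat, Matrix.mul_fin_two]
  simp [Units.val_mul]

/-- `(1 0; 0 1) = 1`. [folklore] -/
theorem bMat_one : bMat (1 : Kˣ) (0 : K) 1 = 1 :=
  Units.ext (by simp [Matrix.one_fin_two])

/-- **Inverse**: `(a b; 0 d)⁻¹ = (a⁻¹, −a⁻¹ b d⁻¹; 0, d⁻¹)`. [folklore] -/
theorem bMat_inv (a : Kˣ) (b : K) (d : Kˣ) :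
    (bMat a b d)⁻¹ = bMat a⁻¹ (-((a⁻¹ : Kˣ) : K) * b * ((d⁻¹ : Kˣ) : K)) d⁻¹ := by
  refine inv_eq_of_mul_eq_one_right ?_
  rw [bMat_mul, mul_inv_cancel, mul_inv_cancel, ← bMat_one]
  congr 1
  have ha : (a : K) * ((a⁻¹ : Kˣ) : K) = 1 := by rw [← Units.val_mul, mul_inv_cancel, Units.val_one]
  calc (a : K) * (-((a⁻¹ : Kˣ) : K) * b * ((d⁻¹ : Kˣ) : K)) + b * ((d⁻¹ : Kˣ) : K)
      = (1 - (a : K) * ((a⁻¹ : Kˣ) : K)) * (b * ((d⁻¹ : Kˣ) : K)) := by ring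
    _ = 0 := by rw [ha, sub_self, zero_mul]

/-- The entries determine `(a, b, d)`. [folklore] -/
theorem bMat_injective {a a' d d' : Kˣ} {b b' : K} (h : bMat a b d = bMat a' b' d') :
    a = a' ∧ b = b' ∧ d = d' := by
  have h' := congrArg (fun g : GL (Fin 2) K => (g : Matrix (Fin 2) (Fin 2) K)) h
  simp only [coe_bMat] at h'
  have h00 := congrFun (congrFun h' 0) 0
  have h01 := congrFun (congrFun h' 0) 1
  have h11 := congrFun (congrFun h' 1) 1
  simp only [Matrix.of_apply, Matrix.cons_val', Matrix.cons_val_zero, Matrix.cons_val_one,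
    Matrix.cons_val_fin_one] at h00 h01 h11
  exact ⟨Units.ext h00, h01, Units.ext h11⟩

/-- Integer powers of a unipotent matrix: `(1 b; 0 1)^m = (1 mb; 0 1)`. [folklore] -/
theorem bMat_unipotent_zpow (b : K) (m : ℤ) : (bMat 1 b 1) ^ m = bMat 1 (m • b) 1 := by
  induction m using Int.induction_on with
  | zero => rw [zpow_zero, zero_smul, bMat_one]
  | succ n ih =>
    rw [zpow_add_one, ih, bMat_mul, one_mul, add_smul, one_smul]
    congr 1
    simp only [Units.val_one, one_mul, mul_one, add_comm]
  | pred n ih =>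
    rw [zpow_sub_one, ih, bMat_inv, bMat_mul, sub_smul, one_smul]
    simp only [inv_one, one_mul, Units.val_one, mul_one, neg_mul]
    congr 1
    ring

/-- Integer powers of a diagonal matrix: `(a 0; 0 d)^m = (a^m 0; 0 d^m)`. [folklore] -/
theorem bMat_diag_zpow (a d : Kˣ) (m : ℤ) : (bMat a 0 d) ^ m = bMat (a ^ m) 0 (d ^ m) := by
  induction m using Int.induction_on with
  | zero => rw [zpow_zero, zpow_zero, zpow_zero, bMat_one]
  | succ n ih =>
    rw [zpow_add_one, ih, bMat_mul, zpow_add_one, zpow_add_one]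
    congr 1
    simp
  | pred n ih =>
    rw [zpow_sub_one, ih, bMat_inv, bMat_mul, zpow_sub_one, zpow_sub_one]
    congr 1
    simp

/-! ### The subgroups `B(Λ, A, D)` -/

/-- **`B(Λ, A, D) = {(a b; 0 d) : a ∈ A, d ∈ D, b ∈ Λ} ≤ GL₂(K)`** for a `ℤ`-submodule `Λ ≤ K` and
subgroups `A, D ≤ Kˣ` with `A Λ ⊆ Λ` and `Λ D ⊆ Λ`. [cite: Harder1987, §2] -/
def borelOf (Λ : Submodule ℤ K) (A D : Subgroup Kˣ) (hA : ∀ a ∈ A, ∀ x ∈ Λ, (a : K) * x ∈ Λ)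
    (hD : ∀ d ∈ D, ∀ x ∈ Λ, x * (d : K) ∈ Λ) : Subgroup (GL (Fin 2) K) where
  carrier := {g | ∃ a ∈ A, ∃ d ∈ D, ∃ b ∈ Λ, g = bMat a b d}
  one_mem' := ⟨1, A.one_mem, 1, D.one_mem, 0, Λ.zero_mem, bMat_one.symm⟩
  mul_mem' := by
    rintro _ _ ⟨a, ha, d, hd, b, hb, rfl⟩ ⟨a', ha', d', hd', b', hb', rfl⟩
    exact ⟨a * a', A.mul_mem ha ha', d * d', D.mul_mem hd hd', (a : K) * b' + b * d',
      Λ.add_mem (hA a ha b' hb') (hD d' hd' b hb), bMat_mul a b d a' b' d'⟩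
  inv_mem' := by
    rintro _ ⟨a, ha, d, hd, b, hb, rfl⟩
    refine ⟨a⁻¹, A.inv_mem ha, d⁻¹, D.inv_mem hd, -((a⁻¹ : Kˣ) : K) * b * ((d⁻¹ : Kˣ) : K), ?_,
      bMat_inv a b d⟩
    have h1 : ((a⁻¹ : Kˣ) : K) * b * ((d⁻¹ : Kˣ) : K) ∈ Λ :=
      hD _ (D.inv_mem hd) _ (hA _ (A.inv_mem ha) b hb)
    have h2 := Λ.neg_mem h1
    rwa [← neg_mul, ← neg_mul] at h2

/-- Membership in `B(Λ, A, D)` (definitional). [folklore] -/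
theorem mem_borelOf_iff {Λ : Submodule ℤ K} {A D : Subgroup Kˣ} {hA : ∀ a ∈ A, ∀ x ∈ Λ, (a : K) * x ∈ Λ}
    {hD : ∀ d ∈ D, ∀ x ∈ Λ, x * (d : K) ∈ Λ} {g : GL (Fin 2) K} :
    g ∈ borelOf Λ A D hA hD ↔ ∃ a ∈ A, ∃ d ∈ D, ∃ b ∈ Λ, g = bMat a b d :=
  Iff.rfl

/-- `bMat a b d ∈ B(Λ, A, D) ↔ a ∈ A ∧ d ∈ D ∧ b ∈ Λ`. [folklore] -/
theorem bMat_mem_borelOf_iff {Λ : Submodule ℤ K} {A D : Subgroup Kˣ} {hA : ∀ a ∈ A, ∀ x ∈ Λ, (a : K) * x ∈ Λ}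
    {hD : ∀ d ∈ D, ∀ x ∈ Λ, x * (d : K) ∈ Λ} {a d : Kˣ} {b : K} :
    bMat a b d ∈ borelOf Λ A D hA hD ↔ a ∈ A ∧ d ∈ D ∧ b ∈ Λ := by
  constructor
  · rintro ⟨a', ha', d', hd', b', hb', h⟩
    obtain ⟨rfl, rfl, rfl⟩ := bMat_injective h
    exact ⟨ha', hd', hb'⟩
  · rintro ⟨ha, hd, hb⟩
    exact ⟨a, ha, d, hd, b, hb, rfl⟩

/-- **Monotonicity** of `B(Λ, A, D)` in `(Λ, A, D)`. [folklore] -/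
theorem borelOf_mono {Λ Λ' : Submodule ℤ K} {A A' D D' : Subgroup Kˣ}
    {hA : ∀ a ∈ A, ∀ x ∈ Λ, (a : K) * x ∈ Λ} {hD : ∀ d ∈ D, ∀ x ∈ Λ, x * (d : K) ∈ Λ}
    {hA' : ∀ a ∈ A', ∀ x ∈ Λ', (a : K) * x ∈ Λ'} {hD' : ∀ d ∈ D', ∀ x ∈ Λ', x * (d : K) ∈ Λ'}
    (hΛ : Λ ≤ Λ') (hAA : A ≤ A') (hDD : D ≤ D') : borelOf Λ A D hA hD ≤ borelOf Λ' A' D' hA' hD' := by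
  rintro _ ⟨a, ha, d, hd, b, hb, rfl⟩
  exact ⟨a, hAA ha, d, hDD hd, b, hΛ hb, rfl⟩

/-- The trivial subgroup preserves every `Λ` (left). [folklore] -/
theorem bot_preserves_left (Λ : Submodule ℤ K) : ∀ a ∈ (⊥ : Subgroup Kˣ), ∀ x ∈ Λ, (a : K) * x ∈ Λ := by
  intro a ha x hx
  rw [Subgroup.mem_bot] at ha
  rwa [ha, Units.val_one, one_mul]

/-- The trivial subgroup preserves every `Λ` (right). [folklore] -/
theorem bot_preserves_right (Λ : Submodule ℤ K) : ∀ d ∈ (⊥ : Subgroup Kˣ), ∀ x ∈ Λ, x * (d : K) ∈ Λ := by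
  intro d hd x hx
  rw [Subgroup.mem_bot] at hd
  rwa [hd, Units.val_one, mul_one]

/-- **The unipotent groups `B(Λ) = B(Λ, 1, 1)` are commutative.** [folklore] -/
theorem borelOf_bot_comm {Λ : Submodule ℤ K} {hA : ∀ a ∈ (⊥ : Subgroup Kˣ), ∀ x ∈ Λ, (a : K) * x ∈ Λ}
    {hD : ∀ d ∈ (⊥ : Subgroup Kˣ), ∀ x ∈ Λ, x * (d : K) ∈ Λ}
    {g h : GL (Fin 2) K} (hg : g ∈ borelOf Λ ⊥ ⊥ hA hD) (hh : h ∈ borelOf Λ ⊥ ⊥ hA hD) :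
    g * h = h * g := by
  obtain ⟨a, ha, d, hd, b, hb, rfl⟩ := hg
  obtain ⟨a', ha', d', hd', b', hb', rfl⟩ := hh
  rw [Subgroup.mem_bot] at ha hd ha' hd'
  subst ha hd ha' hd'
  rw [bMat_mul, bMat_mul]
  congr 1
  simp only [Units.val_one, one_mul, mul_one, add_comm]

/-- **Unipotent steps are normal**: `B(Λ) ⊴ B(Λ')` for `Λ ≤ Λ'` (both commutative). [folklore] -/
theorem borelOf_bot_normal {Λ Λ' : Submodule ℤ K}
    {hA : ∀ a ∈ (⊥ : Subgroup Kˣ), ∀ x ∈ Λ, (a : K) * x ∈ Λ}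
    {hD : ∀ d ∈ (⊥ : Subgroup Kˣ), ∀ x ∈ Λ, x * (d : K) ∈ Λ}
    {hA' : ∀ a ∈ (⊥ : Subgroup Kˣ), ∀ x ∈ Λ', (a : K) * x ∈ Λ'}
    {hD' : ∀ d ∈ (⊥ : Subgroup Kˣ), ∀ x ∈ Λ', x * (d : K) ∈ Λ'} (hΛ : Λ ≤ Λ') :
    ((borelOf Λ ⊥ ⊥ hA hD).subgroupOf (borelOf Λ' ⊥ ⊥ hA' hD')).Normal := by
  refine ⟨fun h hh g => ?_⟩
  rw [Subgroup.mem_subgroupOf] at hh ⊢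
  have hcomm : (g : GL (Fin 2) K) * h = h * g := borelOf_bot_comm g.2 (borelOf_mono hΛ le_rfl le_rfl hh)
  rw [Subgroup.coe_mul, Subgroup.coe_mul, Subgroup.coe_inv, hcomm, mul_inv_cancel_right]
  exact hh

/-- **Diagonal steps are normal**: `B(Λ, A, D) ⊴ B(Λ, A', D')` for `A ≤ A'`, `D ≤ D'` (same `Λ`,
preserved by `A'` and `D'`): conjugation fixes the diagonal and moves the corner inside `Λ`.
[folklore] -/
theorem borelOf_normal {Λ : Submodule ℤ K} {A A' D D' : Subgroup Kˣ}
    {hA : ∀ a ∈ A, ∀ x ∈ Λ, (a : K) * x ∈ Λ} {hD : ∀ d ∈ D, ∀ x ∈ Λ, x * (d : K) ∈ Λ}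
    {hA' : ∀ a ∈ A', ∀ x ∈ Λ, (a : K) * x ∈ Λ} {hD' : ∀ d ∈ D', ∀ x ∈ Λ, x * (d : K) ∈ Λ}
    (hAA : A ≤ A') (hDD : D ≤ D') :
    ((borelOf Λ A D hA hD).subgroupOf (borelOf Λ A' D' hA' hD')).Normal := by
  refine ⟨fun h hh g => ?_⟩
  rw [Subgroup.mem_subgroupOf] at hh ⊢
  obtain ⟨a, ha, d, hd, b, hb, hh'⟩ := hh
  obtain ⟨a', ha', d', hd', b', hb', hg'⟩ := g.2
  rw [Subgroup.coe_mul, Subgroup.coe_mul, Subgroup.coe_inv, hh', hg', bMat_inv, bMat_mul, bMat_mul]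
  refine ⟨a' * a * a'⁻¹, ?_, d' * d * d'⁻¹, ?_, _, ?_, rfl⟩
  · rw [mul_comm (a' * a), ← mul_assoc, inv_mul_cancel, one_mul]; exact ha
  · rw [mul_comm (d' * d), ← mul_assoc, inv_mul_cancel, one_mul]; exact hd
  · -- the corner `(a'a)(−a'⁻¹ b' d'⁻¹) + (a' b + b' d) d'⁻¹ = −a b' d'⁻¹ + a' b d'⁻¹ + b' d d'⁻¹`
    have e : ((a' * a : Kˣ) : K) * (-((a'⁻¹ : Kˣ) : K) * b' * ((d'⁻¹ : Kˣ) : K)) +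
        ((a' : K) * b + b' * d) * ((d'⁻¹ : Kˣ) : K) =
        -((a : K) * b' * ((d'⁻¹ : Kˣ) : K)) + (a' : K) * b * ((d'⁻¹ : Kˣ) : K) +
          b' * (d : K) * ((d'⁻¹ : Kˣ) : K) := by
      have h1 : (a' : K) * ((a'⁻¹ : Kˣ) : K) = 1 := by
        rw [← Units.val_mul, mul_inv_cancel, Units.val_one]
      rw [Units.val_mul]
      linear_combination (-(a : K) * b' * ((d'⁻¹ : Kˣ) : K)) * h1
    rw [e]
    refine Λ.add_mem (Λ.add_mem (Λ.neg_mem ?_) ?_) ?_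
    · exact hD' _ (D'.inv_mem hd') _ (hA' _ (hAA ha) _ hb')
    · exact hD' _ (D'.inv_mem hd') _ (hA' _ ha' _ hb)
    · exact hD' _ (D'.inv_mem hd') _ (hD' _ (hDD hd) _ hb')

/-! ### Multiplicatively independent units: the groups `⟨u₀, …, u_{i−1}⟩` -/

/-- **`unitSpan u i = {∏_l u_l^{e_l} : e_l = 0 for l ≥ i} ≤ Kˣ`**, the subgroup generated by the
first `i` members of the family `u : Fin s → Kˣ`. [folklore] -/
def unitSpan {s : ℕ} (u : Fin s → Kˣ) (i : ℕ) : Subgroup Kˣ where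
  carrier := {x | ∃ e : Fin s → ℤ, (∀ l : Fin s, i ≤ (l : ℕ) → e l = 0) ∧ x = ∏ l, u l ^ e l}
  one_mem' := ⟨0, fun _ _ => rfl, by simp⟩
  mul_mem' := by
    rintro _ _ ⟨e, he, rfl⟩ ⟨e', he', rfl⟩
    refine ⟨e + e', fun l hl => by simp [he l hl, he' l hl], ?_⟩
    rw [← Finset.prod_mul_distrib]
    exact Finset.prod_congr rfl fun l _ => by rw [Pi.add_apply, zpow_add]
  inv_mem' := by
    rintro _ ⟨e, he, rfl⟩
    refine ⟨-e, fun l hl => by simp [he l hl], ?_⟩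
    rw [← Finset.prod_inv_distrib]
    exact Finset.prod_congr rfl fun l _ => by rw [Pi.neg_apply, zpow_neg]

/-- Membership in `unitSpan u i` (definitional). [folklore] -/
theorem mem_unitSpan_iff {s : ℕ} {u : Fin s → Kˣ} {i : ℕ} {x : Kˣ} :
    x ∈ unitSpan u i ↔ ∃ e : Fin s → ℤ, (∀ l : Fin s, i ≤ (l : ℕ) → e l = 0) ∧ x = ∏ l, u l ^ e l :=
  Iff.rfl

/-- `unitSpan u 0 = 1`. [folklore] -/
theorem unitSpan_zero {s : ℕ} (u : Fin s → Kˣ) : unitSpan u 0 = ⊥ := by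
  refine (Subgroup.eq_bot_iff_forall _).2 fun x hx => ?_
  obtain ⟨e, he, rfl⟩ := hx
  exact Finset.prod_eq_one fun l _ => by rw [he l (Nat.zero_le _), zpow_zero]

/-- `unitSpan u i` is monotone in `i`. [folklore] -/
theorem unitSpan_mono {s : ℕ} (u : Fin s → Kˣ) {i j : ℕ} (hij : i ≤ j) : unitSpan u i ≤ unitSpan u j := by
  rintro _ ⟨e, he, rfl⟩
  exact ⟨e, fun l hl => he l (hij.trans hl), rfl⟩

/-- `∏_l u_l^{m δ_{li}} = u_i^m`. [folklore] -/
theorem prod_zpow_single {s : ℕ} (u : Fin s → Kˣ) (i : Fin s) (m : ℤ) :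
    ∏ l, u l ^ (Pi.single i m : Fin s → ℤ) l = u i ^ m := by
  classical
  rw [Finset.prod_eq_single i (fun l _ hl => by rw [Pi.single_eq_of_ne hl, zpow_zero])
    (fun h => absurd (Finset.mem_univ i) h), Pi.single_eq_same]

/-- `∏_l u_l^{(e + e') l} = ∏_l u_l^{e l} · ∏_l u_l^{e' l}`. [folklore] -/
theorem prod_zpow_add {s : ℕ} (u : Fin s → Kˣ) (e e' : Fin s → ℤ) :
    ∏ l, u l ^ (e + e') l = (∏ l, u l ^ e l) * ∏ l, u l ^ e' l := by
  rw [← Finset.prod_mul_distrib]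
  exact Finset.prod_congr rfl fun l _ => by rw [Pi.add_apply, zpow_add]

/-- `u_i ∈ unitSpan u (i + 1)`. [folklore] -/
theorem self_mem_unitSpan_succ {s : ℕ} (u : Fin s → Kˣ) (i : Fin s) : u i ∈ unitSpan u ((i : ℕ) + 1) := by
  classical
  refine ⟨Pi.single i 1, fun l hl => ?_, ?_⟩
  · have : l ≠ i := fun h => by subst h; exact Nat.lt_irrefl _ hl
    rw [Pi.single_eq_of_ne this]
  · rw [prod_zpow_single, zpow_one]

/-- **Decomposition in `unitSpan u (i+1)`**: `x = x₀ · u_i^m` with `x₀ ∈ unitSpan u i`. [folklore] -/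
theorem exists_mem_unitSpan_mul_zpow {s : ℕ} (u : Fin s → Kˣ) (i : Fin s) {x : Kˣ}
    (hx : x ∈ unitSpan u ((i : ℕ) + 1)) : ∃ x₀ ∈ unitSpan u i, ∃ m : ℤ, x = x₀ * u i ^ m := by
  classical
  obtain ⟨e, he, rfl⟩ := hx
  refine ⟨∏ l, u l ^ Function.update e i 0 l, ⟨Function.update e i 0, fun l hl => ?_, rfl⟩, e i, ?_⟩
  · by_cases hli : l = i
    · subst hli; rw [Function.update_self]
    · rw [Function.update_of_ne hli]
      exact he l (by omega)
  · have hdecomp : e = Function.update e i 0 + Pi.single i (e i) := by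
      ext l
      by_cases hli : l = i
      · subst hli; simp
      · simp [Function.update_of_ne hli, Pi.single_eq_of_ne hli]
    conv_lhs => rw [hdecomp]
    rw [prod_zpow_add, prod_zpow_single]

/-- **Freeness**: for a multiplicatively independent family, `u_i^m ∈ unitSpan u i` forces `m = 0`.
[folklore] -/
theorem eq_zero_of_zpow_mem_unitSpan {s : ℕ} {u : Fin s → Kˣ}
    (hu : ∀ e : Fin s → ℤ, ∏ l, u l ^ e l = 1 → e = 0) (i : Fin s) {m : ℤ}
    (hm : u i ^ m ∈ unitSpan u i) : m = 0 := by
  classical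
  obtain ⟨e, he, h⟩ := hm
  -- `∏ u_l^{e_l − m δ_{li}} = 1`
  have hprod : ∏ l, u l ^ (e + -(Pi.single i m : Fin s → ℤ)) l = 1 := by
    rw [prod_zpow_add, ← h, ← Pi.single_neg, prod_zpow_single, zpow_neg, mul_inv_cancel]
  have h0 := congrFun (hu _ hprod) i
  rw [Pi.add_apply, Pi.neg_apply, Pi.single_eq_same, he i le_rfl, zero_add, Pi.zero_apply, neg_eq_zero] at h0
  exact h0

/-! ### The chain and its cohomological finiteness -/

section Chain

variable {r s s' : ℕ} (b : Fin r → K) (u : Fin s → Kˣ) (u' : Fin s' → Kˣ)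

/-- The lattices `Λ_j = ℤ b₀ ⊕ ⋯ ⊕ ℤ b_{j−1}` of the unipotent part of the chain (`Λ_j = Λ_r` for
`j ≥ r`). [folklore] -/
def latticeStep (j : ℕ) : Submodule ℤ K :=
  Submodule.span ℤ (b '' {i : Fin r | (i : ℕ) < j})

/-- `Λ_j` is monotone. [folklore] -/
theorem latticeStep_mono {j j' : ℕ} (h : j ≤ j') : latticeStep b j ≤ latticeStep b j' :=
  Submodule.span_mono (Set.image_mono fun i (hi : (i : ℕ) < j) => lt_of_lt_of_le hi h)

/-- `Λ_j = ℤ-span of all `bᵢ` for `j ≥ r`. [folklore] -/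
theorem latticeStep_of_le {j : ℕ} (h : r ≤ j) : latticeStep b j = Submodule.span ℤ (Set.range b) := by
  rw [latticeStep]
  congr 1
  ext x
  constructor
  · rintro ⟨i, -, rfl⟩; exact ⟨i, rfl⟩
  · rintro ⟨i, rfl⟩; exact ⟨i, lt_of_lt_of_le i.2 h, rfl⟩

/-- Every `unitSpan u i` preserves `Λ = Λ_r` (left) when `unitSpan u s` does. [folklore] -/
theorem unitSpan_preserves_left
    (hAΛ : ∀ a ∈ unitSpan u s, ∀ x ∈ Submodule.span ℤ (Set.range b), (a : K) * x ∈ Submodule.span ℤ (Set.range b))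
    (i : ℕ) :
    ∀ a ∈ unitSpan u i, ∀ x ∈ latticeStep b r, (a : K) * x ∈ latticeStep b r := by
  intro a ha x hx
  rw [latticeStep_of_le b le_rfl] at hx ⊢
  by_cases hi : i ≤ s
  · exact hAΛ a (unitSpan_mono u hi ha) x hx
  · obtain ⟨e, he, rfl⟩ := ha
    exact hAΛ _ ⟨e, fun l hl => he l (by omega), rfl⟩ x hx

/-- Every `unitSpan u' i` preserves `Λ = Λ_r` (right) when `unitSpan u' s'` does. [folklore] -/
theorem unitSpan_preserves_right
    (hDΛ : ∀ d ∈ unitSpan u' s', ∀ x ∈ Submodule.span ℤ (Set.range b), x * (d : K) ∈ Submodule.span ℤ (Set.range b))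
    (i : ℕ) :
    ∀ d ∈ unitSpan u' i, ∀ x ∈ latticeStep b r, x * (d : K) ∈ latticeStep b r := by
  intro d hd x hx
  rw [latticeStep_of_le b le_rfl] at hx ⊢
  by_cases hi : i ≤ s'
  · exact hDΛ d (unitSpan_mono u' hi hd) x hx
  · obtain ⟨e, he, rfl⟩ := hd
    exact hDΛ _ ⟨e, fun l hl => he l (by omega), rfl⟩ x hx

/-- **The chain** `B(Λ_0) ≤ ⋯ ≤ B(Λ_r) ≤ B(Λ, ⟨u₀⟩) ≤ ⋯ ≤ B(Λ, A) ≤ B(Λ, A, ⟨u'₀⟩) ≤ ⋯ ≤ B(Λ, A, D)`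
(`A = unitSpan u s`, `D = unitSpan u' s'`), indexed by `ℕ` (constant from `r + s + s'` on).
[folklore] -/
def chain
    (hAΛ : ∀ a ∈ unitSpan u s, ∀ x ∈ Submodule.span ℤ (Set.range b), (a : K) * x ∈ Submodule.span ℤ (Set.range b))
    (hDΛ : ∀ d ∈ unitSpan u' s', ∀ x ∈ Submodule.span ℤ (Set.range b), x * (d : K) ∈ Submodule.span ℤ (Set.range b))
    (i : ℕ) : Subgroup (GL (Fin 2) K) :=
  if i ≤ r then
    borelOf (latticeStep b i) ⊥ ⊥ (bot_preserves_left _) (bot_preserves_right _)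
  else if i ≤ r + s then
    borelOf (latticeStep b r) (unitSpan u (i - r)) ⊥ (unitSpan_preserves_left b u hAΛ (i - r))
      (bot_preserves_right _)
  else
    borelOf (latticeStep b r) (unitSpan u s) (unitSpan u' (i - r - s))
      (unitSpan_preserves_left b u hAΛ s) (unitSpan_preserves_right b u' hDΛ (i - r - s))

/-- The chain in the unipotent range. [folklore] -/
theorem chain_of_le_r
    (hAΛ : ∀ a ∈ unitSpan u s, ∀ x ∈ Submodule.span ℤ (Set.range b), (a : K) * x ∈ Submodule.span ℤ (Set.range b))
    (hDΛ : ∀ d ∈ unitSpan u' s', ∀ x ∈ Submodule.span ℤ (Set.range b), x * (d : K) ∈ Submodule.span ℤ (Set.range b))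
    {i : ℕ} (hi : i ≤ r) :
    chain b u u' hAΛ hDΛ i = borelOf (latticeStep b i) ⊥ ⊥ (bot_preserves_left _) (bot_preserves_right _) := by
  rw [chain, if_pos hi]

/-- The chain in the `A`-range. [folklore] -/
theorem chain_of_r_lt
    (hAΛ : ∀ a ∈ unitSpan u s, ∀ x ∈ Submodule.span ℤ (Set.range b), (a : K) * x ∈ Submodule.span ℤ (Set.range b))
    (hDΛ : ∀ d ∈ unitSpan u' s', ∀ x ∈ Submodule.span ℤ (Set.range b), x * (d : K) ∈ Submodule.span ℤ (Set.range b))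
    {i : ℕ} (hi : r < i) (hi' : i ≤ r + s) :
    chain b u u' hAΛ hDΛ i = borelOf (latticeStep b r) (unitSpan u (i - r)) ⊥
      (unitSpan_preserves_left b u hAΛ (i - r)) (bot_preserves_right _) := by
  rw [chain, if_neg (not_le.2 hi), if_pos hi']

/-- The chain in the `D`-range. [folklore] -/
theorem chain_of_rs_lt
    (hAΛ : ∀ a ∈ unitSpan u s, ∀ x ∈ Submodule.span ℤ (Set.range b), (a : K) * x ∈ Submodule.span ℤ (Set.range b))
    (hDΛ : ∀ d ∈ unitSpan u' s', ∀ x ∈ Submodule.span ℤ (Set.range b), x * (d : K) ∈ Submodule.span ℤ (Set.range b))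
    {i : ℕ} (hi : r + s < i) :
    chain b u u' hAΛ hDΛ i = borelOf (latticeStep b r) (unitSpan u s) (unitSpan u' (i - r - s))
      (unitSpan_preserves_left b u hAΛ s) (unitSpan_preserves_right b u' hDΛ (i - r - s)) := by
  rw [chain, if_neg (by omega), if_neg (not_le.2 hi)]

/-- The point `r` of the chain in its second description: `B(Λ_r) = B(Λ_r, unitSpan u 0, 1)`.
[folklore] -/
theorem chain_r_eq
    (hAΛ : ∀ a ∈ unitSpan u s, ∀ x ∈ Submodule.span ℤ (Set.range b), (a : K) * x ∈ Submodule.span ℤ (Set.range b))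
    (hDΛ : ∀ d ∈ unitSpan u' s', ∀ x ∈ Submodule.span ℤ (Set.range b), x * (d : K) ∈ Submodule.span ℤ (Set.range b)) :
    chain b u u' hAΛ hDΛ r = borelOf (latticeStep b r) (unitSpan u 0) ⊥
      (unitSpan_preserves_left b u hAΛ 0) (bot_preserves_right _) := by
  rw [chain_of_le_r b u u' hAΛ hDΛ le_rfl]
  ext g
  simp only [mem_borelOf_iff, unitSpan_zero]

/-- The point `r + s` of the chain in its third description. [folklore] -/
theorem chain_rs_eq
    (hAΛ : ∀ a ∈ unitSpan u s, ∀ x ∈ Submodule.span ℤ (Set.range b), (a : K) * x ∈ Submodule.span ℤ (Set.range b))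
    (hDΛ : ∀ d ∈ unitSpan u' s', ∀ x ∈ Submodule.span ℤ (Set.range b), x * (d : K) ∈ Submodule.span ℤ (Set.range b)) :
    chain b u u' hAΛ hDΛ (r + s) = borelOf (latticeStep b r) (unitSpan u s) (unitSpan u' 0)
      (unitSpan_preserves_left b u hAΛ s) (unitSpan_preserves_right b u' hDΛ 0) := by
  rcases Nat.eq_zero_or_pos s with hs | hs
  · subst hs
    rw [Nat.add_zero, chain_r_eq]
    ext g
    simp only [mem_borelOf_iff, unitSpan_zero]
  · rw [chain_of_r_lt b u u' hAΛ hDΛ (by omega) le_rfl, Nat.add_sub_cancel_left]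
    ext g
    simp only [mem_borelOf_iff, unitSpan_zero]

/-- The last point of the chain: `B(Λ, A, D)`. [folklore] -/
theorem chain_last
    (hAΛ : ∀ a ∈ unitSpan u s, ∀ x ∈ Submodule.span ℤ (Set.range b), (a : K) * x ∈ Submodule.span ℤ (Set.range b))
    (hDΛ : ∀ d ∈ unitSpan u' s', ∀ x ∈ Submodule.span ℤ (Set.range b), x * (d : K) ∈ Submodule.span ℤ (Set.range b)) :
    chain b u u' hAΛ hDΛ (r + s + s') = borelOf (latticeStep b r) (unitSpan u s) (unitSpan u' s')
      (unitSpan_preserves_left b u hAΛ s) (unitSpan_preserves_right b u' hDΛ s') := by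
  rcases Nat.eq_zero_or_pos s' with hs' | hs'
  · subst hs'
    rw [Nat.add_zero, chain_rs_eq]
  · rw [chain_of_rs_lt b u u' hAΛ hDΛ (by omega)]
    ext g
    simp only [mem_borelOf_iff, show r + s + s' - r - s = s' by omega]

/-- The chain starts at the trivial group. [folklore] -/
theorem chain_zero_eq_bot
    (hAΛ : ∀ a ∈ unitSpan u s, ∀ x ∈ Submodule.span ℤ (Set.range b), (a : K) * x ∈ Submodule.span ℤ (Set.range b))
    (hDΛ : ∀ d ∈ unitSpan u' s', ∀ x ∈ Submodule.span ℤ (Set.range b), x * (d : K) ∈ Submodule.span ℤ (Set.range b))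
    : chain b u u' hAΛ hDΛ 0 = ⊥ := by
  rw [chain_of_le_r b u u' hAΛ hDΛ (Nat.zero_le _)]
  refine (Subgroup.eq_bot_iff_forall _).2 fun g hg => ?_
  obtain ⟨a, ha, d, hd, x, hx, rfl⟩ := hg
  rw [Subgroup.mem_bot] at ha hd
  subst ha hd
  have hx0 : x = 0 := by
    have : latticeStep b 0 = ⊥ := by
      rw [latticeStep, Submodule.span_eq_bot]
      rintro _ ⟨i, hi, rfl⟩
      exact absurd hi (Nat.not_lt_zero _)
    rw [this] at hx
    exact (Submodule.mem_bot ℤ).1 hx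
  rw [hx0, bMat_one]

/-- **The chain is monotone.** [folklore] -/
theorem chain_le_succ
    (hAΛ : ∀ a ∈ unitSpan u s, ∀ x ∈ Submodule.span ℤ (Set.range b), (a : K) * x ∈ Submodule.span ℤ (Set.range b))
    (hDΛ : ∀ d ∈ unitSpan u' s', ∀ x ∈ Submodule.span ℤ (Set.range b), x * (d : K) ∈ Submodule.span ℤ (Set.range b))
    (i : ℕ) (hi : i < r + s + s') : chain b u u' hAΛ hDΛ i ≤ chain b u u' hAΛ hDΛ (i + 1) := by
  rcases Nat.lt_or_ge i r with h1 | h1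
  · rw [chain_of_le_r b u u' hAΛ hDΛ h1.le, chain_of_le_r b u u' hAΛ hDΛ h1]
    exact borelOf_mono (latticeStep_mono b (Nat.le_succ i)) le_rfl le_rfl
  rcases Nat.lt_or_ge i (r + s) with h2 | h2
  · have e1 : chain b u u' hAΛ hDΛ i = borelOf (latticeStep b r) (unitSpan u (i - r)) ⊥
        (unitSpan_preserves_left b u hAΛ (i - r)) (bot_preserves_right _) := by
      rcases h1.eq_or_lt with h | h
      · subst h; rw [Nat.sub_self]; exact chain_r_eq b u u' hAΛ hDΛ
      · exact chain_of_r_lt b u u' hAΛ hDΛ h h2.le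
    rw [e1, chain_of_r_lt b u u' hAΛ hDΛ (by omega) h2, show i + 1 - r = i - r + 1 by omega]
    exact borelOf_mono le_rfl (unitSpan_mono u (Nat.le_succ _)) le_rfl
  · have e1 : chain b u u' hAΛ hDΛ i = borelOf (latticeStep b r) (unitSpan u s) (unitSpan u' (i - r - s))
        (unitSpan_preserves_left b u hAΛ s) (unitSpan_preserves_right b u' hDΛ (i - r - s)) := by
      rcases h2.eq_or_lt with h | h
      · subst h; rw [show r + s - r - s = 0 by omega]; exact chain_rs_eq b u u' hAΛ hDΛ
      · exact chain_of_rs_lt b u u' hAΛ hDΛ h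
    rw [e1, chain_of_rs_lt b u u' hAΛ hDΛ (by omega), show i + 1 - r - s = i - r - s + 1 by omega]
    exact borelOf_mono le_rfl le_rfl (unitSpan_mono u' (Nat.le_succ _))

/-- **Each step of the chain is normal in the next.** [folklore] -/
theorem chain_normal
    (hAΛ : ∀ a ∈ unitSpan u s, ∀ x ∈ Submodule.span ℤ (Set.range b), (a : K) * x ∈ Submodule.span ℤ (Set.range b))
    (hDΛ : ∀ d ∈ unitSpan u' s', ∀ x ∈ Submodule.span ℤ (Set.range b), x * (d : K) ∈ Submodule.span ℤ (Set.range b))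
    (i : ℕ) (hi : i < r + s + s') :
    ((chain b u u' hAΛ hDΛ i).subgroupOf (chain b u u' hAΛ hDΛ (i + 1))).Normal := by
  rcases Nat.lt_or_ge i r with h1 | h1
  · rw [chain_of_le_r b u u' hAΛ hDΛ h1.le, chain_of_le_r b u u' hAΛ hDΛ h1]
    exact borelOf_bot_normal (latticeStep_mono b (Nat.le_succ i))
  rcases Nat.lt_or_ge i (r + s) with h2 | h2
  · have e1 : chain b u u' hAΛ hDΛ i = borelOf (latticeStep b r) (unitSpan u (i - r)) ⊥
        (unitSpan_preserves_left b u hAΛ (i - r)) (bot_preserves_right _) := by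
      rcases h1.eq_or_lt with h | h
      · subst h; rw [Nat.sub_self]; exact chain_r_eq b u u' hAΛ hDΛ
      · exact chain_of_r_lt b u u' hAΛ hDΛ h h2.le
    rw [e1, chain_of_r_lt b u u' hAΛ hDΛ (by omega) h2, show i + 1 - r = i - r + 1 by omega]
    exact borelOf_normal (unitSpan_mono u (Nat.le_succ _)) le_rfl
  · have e1 : chain b u u' hAΛ hDΛ i = borelOf (latticeStep b r) (unitSpan u s) (unitSpan u' (i - r - s))
        (unitSpan_preserves_left b u hAΛ s) (unitSpan_preserves_right b u' hDΛ (i - r - s)) := by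
      rcases h2.eq_or_lt with h | h
      · subst h; rw [show r + s - r - s = 0 by omega]; exact chain_rs_eq b u u' hAΛ hDΛ
      · exact chain_of_rs_lt b u u' hAΛ hDΛ h
    rw [e1, chain_of_rs_lt b u u' hAΛ hDΛ (by omega), show i + 1 - r - s = i - r - s + 1 by omega]
    exact borelOf_normal le_rfl (unitSpan_mono u' (Nat.le_succ _))

/-- **Unipotent steps have infinite cyclic quotient**, generated by `n(b_i) = (1 b_i; 0 1)`.
[folklore] -/
theorem chain_cyclic_unipotent
    (hAΛ : ∀ a ∈ unitSpan u s, ∀ x ∈ Submodule.span ℤ (Set.range b), (a : K) * x ∈ Submodule.span ℤ (Set.range b))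
    (hDΛ : ∀ d ∈ unitSpan u' s', ∀ x ∈ Submodule.span ℤ (Set.range b), x * (d : K) ∈ Submodule.span ℤ (Set.range b))
    (hb : LinearIndependent ℤ b) (i : Fin r) :
    ∃ t ∈ chain b u u' hAΛ hDΛ ((i : ℕ) + 1),
      (∀ g ∈ chain b u u' hAΛ hDΛ ((i : ℕ) + 1), ∃ h ∈ chain b u u' hAΛ hDΛ i, ∃ n : ℤ, g = h * t ^ n) ∧
      (∀ n : ℤ, t ^ n ∈ chain b u u' hAΛ hDΛ i → n = 0) := by
  have hi1 : (i : ℕ) + 1 ≤ r := i.2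
  rw [chain_of_le_r b u u' hAΛ hDΛ hi1, chain_of_le_r b u u' hAΛ hDΛ (Nat.le_of_lt i.2)]
  have hbi : b i ∈ latticeStep b ((i : ℕ) + 1) := Submodule.subset_span ⟨i, Nat.lt_succ_self _, rfl⟩
  refine ⟨bMat 1 (b i) 1, bMat_mem_borelOf_iff.2 ⟨Subgroup.one_mem _, Subgroup.one_mem _, hbi⟩,
    fun g hg => ?_, fun n hn => ?_⟩
  · obtain ⟨a, ha, d, hd, x, hx, rfl⟩ := hg
    rw [Subgroup.mem_bot] at ha hd
    subst ha hd
    -- `Λ_{i+1} = Λ_i + ℤ b_i`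
    have hsplit : latticeStep b ((i : ℕ) + 1) = latticeStep b i ⊔ Submodule.span ℤ {b i} := by
      rw [latticeStep, latticeStep, ← Submodule.span_union]
      congr 1
      ext y
      simp only [Set.mem_image, Set.mem_setOf_eq, Set.mem_union, Set.mem_singleton_iff]
      constructor
      · rintro ⟨j, hj, rfl⟩
        rcases (Nat.lt_succ_iff_lt_or_eq.1 hj) with hj' | hj'
        · exact Or.inl ⟨j, hj', rfl⟩
        · exact Or.inr (by rw [Fin.ext hj'])
      · rintro (⟨j, hj, rfl⟩ | rfl)
        · exact ⟨j, Nat.lt_succ_of_lt hj, rfl⟩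
        · exact ⟨i, Nat.lt_succ_self _, rfl⟩
    rw [hsplit, Submodule.mem_sup] at hx
    obtain ⟨y, hy, z, hz, rfl⟩ := hx
    obtain ⟨n, rfl⟩ := Submodule.mem_span_singleton.1 hz
    refine ⟨bMat 1 y 1, bMat_mem_borelOf_iff.2 ⟨Subgroup.one_mem _, Subgroup.one_mem _, hy⟩, n, ?_⟩
    rw [bMat_unipotent_zpow, bMat_mul, one_mul]
    congr 1
    simp [add_comm]
  · rw [bMat_unipotent_zpow, bMat_mem_borelOf_iff] at hn
    have hsub : b '' {j : Fin r | (j : ℕ) < i} ⊆ b '' (Set.univ \ {i}) :=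
      Set.image_mono fun j hj => ⟨Set.mem_univ j, fun h => by
        rw [Set.mem_singleton_iff] at h
        rw [h] at hj
        exact Nat.lt_irrefl _ hj⟩
    have hmem : n • b i ∈ Submodule.span ℤ (b '' (Set.univ \ {i})) := Submodule.span_mono hsub hn.2.2
    exact hb.eq_zero_of_smul_mem_span i n hmem

/-- **`A`-steps have infinite cyclic quotient**, generated by `diag(u_i, 1)`. [folklore] -/
theorem chain_cyclic_left
    (hAΛ : ∀ a ∈ unitSpan u s, ∀ x ∈ Submodule.span ℤ (Set.range b), (a : K) * x ∈ Submodule.span ℤ (Set.range b))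
    (hDΛ : ∀ d ∈ unitSpan u' s', ∀ x ∈ Submodule.span ℤ (Set.range b), x * (d : K) ∈ Submodule.span ℤ (Set.range b))
    (hu : ∀ e : Fin s → ℤ, ∏ l, u l ^ e l = 1 → e = 0) (i : Fin s) :
    ∃ t ∈ chain b u u' hAΛ hDΛ (r + i + 1),
      (∀ g ∈ chain b u u' hAΛ hDΛ (r + i + 1), ∃ h ∈ chain b u u' hAΛ hDΛ (r + i), ∃ n : ℤ, g = h * t ^ n) ∧
      (∀ n : ℤ, t ^ n ∈ chain b u u' hAΛ hDΛ (r + i) → n = 0) := by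
  have e0 : chain b u u' hAΛ hDΛ (r + i) = borelOf (latticeStep b r) (unitSpan u i) ⊥
      (unitSpan_preserves_left b u hAΛ i) (bot_preserves_right _) := by
    rcases Nat.eq_zero_or_pos i with h | h
    · rw [h, Nat.add_zero]; exact chain_r_eq b u u' hAΛ hDΛ
    · rw [chain_of_r_lt b u u' hAΛ hDΛ (by omega) (by omega), Nat.add_sub_cancel_left]
  rw [e0, chain_of_r_lt b u u' hAΛ hDΛ (by omega) (by omega), show r + i + 1 - r = i + 1 by omega]
  refine ⟨bMat (u i) 0 1, bMat_mem_borelOf_iff.2 ⟨self_mem_unitSpan_succ u i, Subgroup.one_mem _,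
    Submodule.zero_mem _⟩, fun g hg => ?_, fun n hn => ?_⟩
  · obtain ⟨a, ha, d, hd, x, hx, rfl⟩ := hg
    rw [Subgroup.mem_bot] at hd
    subst hd
    obtain ⟨a₀, ha₀, n, rfl⟩ := exists_mem_unitSpan_mul_zpow u i ha
    refine ⟨bMat a₀ x 1, bMat_mem_borelOf_iff.2 ⟨ha₀, Subgroup.one_mem _, hx⟩, n, ?_⟩
    rw [bMat_diag_zpow, one_zpow, bMat_mul, mul_one]
    congr 1
    simp
  · rw [bMat_diag_zpow, one_zpow, bMat_mem_borelOf_iff] at hn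
    exact eq_zero_of_zpow_mem_unitSpan hu i hn.1

/-- **`D`-steps have infinite cyclic quotient**, generated by `diag(1, u'_i)`. [folklore] -/
theorem chain_cyclic_right
    (hAΛ : ∀ a ∈ unitSpan u s, ∀ x ∈ Submodule.span ℤ (Set.range b), (a : K) * x ∈ Submodule.span ℤ (Set.range b))
    (hDΛ : ∀ d ∈ unitSpan u' s', ∀ x ∈ Submodule.span ℤ (Set.range b), x * (d : K) ∈ Submodule.span ℤ (Set.range b))
    (hu' : ∀ e : Fin s' → ℤ, ∏ l, u' l ^ e l = 1 → e = 0) (i : Fin s') :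
    ∃ t ∈ chain b u u' hAΛ hDΛ (r + s + i + 1),
      (∀ g ∈ chain b u u' hAΛ hDΛ (r + s + i + 1), ∃ h ∈ chain b u u' hAΛ hDΛ (r + s + i),
        ∃ n : ℤ, g = h * t ^ n) ∧
      (∀ n : ℤ, t ^ n ∈ chain b u u' hAΛ hDΛ (r + s + i) → n = 0) := by
  have e0 : chain b u u' hAΛ hDΛ (r + s + i) = borelOf (latticeStep b r) (unitSpan u s) (unitSpan u' i)
      (unitSpan_preserves_left b u hAΛ s) (unitSpan_preserves_right b u' hDΛ i) := by
    rcases Nat.eq_zero_or_pos i with h | h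
    · rw [h, Nat.add_zero]; exact chain_rs_eq b u u' hAΛ hDΛ
    · rw [chain_of_rs_lt b u u' hAΛ hDΛ (by omega), show r + s + i - r - s = i by omega]
  rw [e0, chain_of_rs_lt b u u' hAΛ hDΛ (by omega), show r + s + i + 1 - r - s = i + 1 by omega]
  refine ⟨bMat 1 0 (u' i), bMat_mem_borelOf_iff.2 ⟨Subgroup.one_mem _, self_mem_unitSpan_succ u' i,
    Submodule.zero_mem _⟩, fun g hg => ?_, fun n hn => ?_⟩
  · obtain ⟨a, ha, d, hd, x, hx, rfl⟩ := hg
    obtain ⟨d₀, hd₀, n, rfl⟩ := exists_mem_unitSpan_mul_zpow u' i hd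
    -- `(a x; 0 d₀ u'^n) = (a, x u'^{-n}; 0, d₀) · diag(1, u'^n)`
    refine ⟨bMat a (x * (((u' i ^ n)⁻¹ : Kˣ) : K)) d₀, bMat_mem_borelOf_iff.2 ⟨ha, hd₀, ?_⟩, n, ?_⟩
    · exact unitSpan_preserves_right b u' hDΛ ((i : ℕ) + 1) _
        (Subgroup.inv_mem _ (Subgroup.zpow_mem _ (self_mem_unitSpan_succ u' i) n)) x hx
    · rw [bMat_diag_zpow, one_zpow, bMat_mul, mul_one]
      congr 1
      rw [mul_zero, zero_add, mul_assoc, ← Units.val_mul, inv_mul_cancel, Units.val_one, mul_one]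
  · rw [bMat_diag_zpow, one_zpow, bMat_mem_borelOf_iff] at hn
    exact eq_zero_of_zpow_mem_unitSpan hu' i hn.2.1

/-- **`Hⁿ(B(Λ, A, D), V)` is finitely generated** over a Noetherian `k` for `V` finitely generated,
when `Λ = ⊕ᵢ ℤ bᵢ` (`b` linearly independent over `ℤ`) and `A = ⟨u⟩`, `D = ⟨u'⟩` are generated by
multiplicatively independent families preserving `Λ`: the group is poly-ℤ along `BorelLattice.chain`.
[cite: Harder1987, §2] [cite: Brown1982CohomologyGroups, VIII §2] -/
theorem moduleFinite_groupCohomology_borelOf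
    (hAΛ : ∀ a ∈ unitSpan u s, ∀ x ∈ Submodule.span ℤ (Set.range b), (a : K) * x ∈ Submodule.span ℤ (Set.range b))
    (hDΛ : ∀ d ∈ unitSpan u' s', ∀ x ∈ Submodule.span ℤ (Set.range b), x * (d : K) ∈ Submodule.span ℤ (Set.range b))
    (hb : LinearIndependent ℤ b) (hu : ∀ e : Fin s → ℤ, ∏ l, u l ^ e l = 1 → e = 0)
    (hu' : ∀ e : Fin s' → ℤ, ∏ l, u' l ^ e l = 1 → e = 0) {k : Type} [CommRing k] [IsNoetherianRing k]
    (V : Rep k (borelOf (Submodule.span ℤ (Set.range b)) (unitSpan u s) (unitSpan u' s') hAΛ hDΛ))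
    [Module.Finite k V] (n : ℕ) : Module.Finite k (groupCohomology V n) := by
  -- the last point of the chain is the group in question
  have hlast : chain b u u' hAΛ hDΛ (r + s + s') =
      borelOf (Submodule.span ℤ (Set.range b)) (unitSpan u s) (unitSpan u' s') hAΛ hDΛ := by
    rw [chain_last]
    ext g
    simp only [mem_borelOf_iff, latticeStep_of_le b le_rfl]
  -- (FC) at the start: the trivial group
  have h0 : ∀ (B : Rep k (chain b u u' hAΛ hDΛ 0)), Module.Finite k B → ∀ n,
      Module.Finite k (groupCohomology B n) := fun B hB n => by
    haveI := hB
    haveI : Subsingleton (chain b u u' hAΛ hDΛ 0) := by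
      rw [chain_zero_eq_bot]
      exact ⟨fun x y => Subtype.ext ((Subgroup.mem_bot.1 x.2).trans (Subgroup.mem_bot.1 y.2).symm)⟩
    exact Literature.Algebra.Homology.moduleFinite_groupCohomology_of_subsingleton B n
  have hcyc : ∀ i < r + s + s', ∃ t ∈ chain b u u' hAΛ hDΛ (i + 1),
      (∀ g ∈ chain b u u' hAΛ hDΛ (i + 1), ∃ h ∈ chain b u u' hAΛ hDΛ i, ∃ n : ℤ, g = h * t ^ n) ∧
      (∀ n : ℤ, t ^ n ∈ chain b u u' hAΛ hDΛ i → n = 0) := by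
    intro i hi
    rcases Nat.lt_or_ge i r with h1 | h1
    · exact chain_cyclic_unipotent b u u' hAΛ hDΛ hb ⟨i, h1⟩
    rcases Nat.lt_or_ge i (r + s) with h2 | h2
    · obtain ⟨j, rfl⟩ : ∃ j, i = r + j := ⟨i - r, by omega⟩
      exact chain_cyclic_left b u u' hAΛ hDΛ hu ⟨j, by omega⟩
    · obtain ⟨j, rfl⟩ : ∃ j, i = r + s + j := ⟨i - r - s, by omega⟩
      exact chain_cyclic_right b u u' hAΛ hDΛ hu' ⟨j, by omega⟩
  have key := Literature.Algebra.Homology.moduleFinite_groupCohomology_of_chain (chain b u u' hAΛ hDΛ) h0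
    (r + s + s') (fun i hi => chain_le_succ b u u' hAΛ hDΛ i hi) (fun i hi => chain_normal b u u' hAΛ hDΛ i hi)
    hcyc
  exact Literature.Algebra.Homology.moduleFinite_groupCohomology_of_mulEquiv (MulEquiv.subgroupCongr hlast)
    key V n

end Chain

end BorelLattice

end Literature.NumberTheory.Automorphic

end
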